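import Summits.AtomisticToContinuum.Crystallization.Theorems.FreeSplittingCertificatesStrictSplittingRuleDefs
import Summits.AtomisticToContinuum.Crystallization.Theorems.FreeSplittingCertificatesPeriodicUpperBound
import Summits.AtomisticToContinuum.Crystallization.Theorems.FreeSplittingCertificatesShellRigidityHcpStubNormFacts
import Literature.MathematicalPhysics.StatisticalMechanics.LennardJonesClusters

/-!
# `StrictSplittingRule` (stmt-AtomisticToContinuum-12560), line `birth`: stub `stub_perturbativeReduction` (S2b from its core, reshape r2)

S2b asks, at the hcp-family minimiser `(a,h)`, `h = (1+t)a√(2/3)`, for every tolerance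
`η₀ ∈ (0, a/100]` and all radii `R ≥ R₀`, a pair-splitting rule `Φ` with (ii) weighted site energy
`≥ e_∞` at every GOOD site (first shell `η₀`-close to `S(a,t)`) and (iii) strictness at good sites.
This file is the sorry-free STRUCTURAL part of S2b (registered stub `stub_perturbativeReduction`: the
registered S2b signature from the core hypothesis); it isolates the analytic core exactly (the vocabulary
`patternShell GoodAt compositeRule bondPattern goodSum PerturbativeCore` is the line's Defs file):

* §1 (sign of the potential) `perturbative_lennardJones_neg_iff`: for `r > 0`, `V_LJ(r) < 0 ↔ 1/2 < r⁶`
  (sharp threshold `2^{-1/6} ≈ 0.8909`); `V_LJ(r) < 0` for `r ≥ 9/10`.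
* §2 (the rule) goodness of an endpoint is READ OFF THE PATTERN (`patternShell a T w`, the
  recentred `5a/4`-shell of `T` around `w`; `GoodAt`).  Composite rule `compositeRule`:
  inner rule `Φ₀` on good–good and bad–bad bonds; on a good–bad bond the GOOD end takes weight `0` if
  the bond is attractive (`V ≤ 0`) and `1` if repulsive.  `perturbative_isRule`: `IsRule Φ₀ → IsRule
  (compositeRule a t η₀ Φ₀)` (the swap `v ↦ −v, T ↦ T − v` exchanges the two endpoint shells).
* §3 (realised patterns) for `R ≥ 5a/4` and injective `x` the joint pattern of the bond `(k,j)` shows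
  both first shells exactly (`perturbative_patternShell_realised_zero/far`); hence at a good site the
  composite rule's weighted energy is `≥` its good-neighbour part under `Φ₀` (`perturbative_siteE_ge`):
  bad neighbours only help, and NO lower bound on `a` is needed (the sign split replaces "all bonds
  attractive").
* §4 (geometry of a good site) `S(a,t)` has twelve points of norm in `(0.99a, 1.01a)`
  (`perturbative_card_target`, via `ShellRigidityHcpBirth.stub_normFacts`); a good site has exactly twelve
  sites within `5a/4`, at distance in `(0.99a − η₀, 1.01a + η₀)`, all other sites beyond `0.98a`
  (`perturbative_dist_of_good`), all bonds strictly attractive once `a ≥ 45/49`.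
* §5 (reduction) `PerturbativeCore δ a t η₀ e` — SITEWISE COERCIVITY OF THE GOOD-NEIGHBOUR SUM: some rule
  `Φ₀` makes, at every good site of every `δ`-separated configuration, the `Φ₀`-weighted energy of the
  bonds to GOOD neighbours `≥ e`, and `< e + c(η)` only for `η`-close shells.
  `perturbative_certificate_of_core`: `eInf ≤ e → Core → S2b(δ,a,t,η₀)`; `perturbative_stub_of_core`: with
  `e := e(hcp(a,h))` (`eInf ≤ e` = `PeriodicUpperBound`, landed) the registered signature follows
  VERBATIM.  The remaining obligation is a statement about LJ lattice sums near hcp only (no `e_∞`, no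
  ground states, no bonds to defective sites).

## Gap analysis (why the core is not closed; what crux `PhononStability` 9333 does not supply)

1. ZERO BUDGET.  `e_∞ = e(hcp(a,h))` is expected (family minimiser = conjectured LJ ground state), so (ii)
   has NO constant slack: in the infinite relaxed crystal every site is good and the mean weighted site
   energy is exactly `e(hcp)`, so every site must sit exactly at the threshold.
2. FIRST ORDER.  Any rule whose good–good weight ignores the displacement pattern (e.g. `0 / 1 / ½`) FAILS
   (ii) if `e_∞ = e(hcp)`: breathing the twelve neighbours of one site `k` outward by `ε` keeps every site
   `ε`-good and changes `k`'s half-split energy by `6 V'(a) ε ≈ −1.4 ε` (`V'(0.9713) ≈ −0.234` for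
   `V = r⁻¹²/12 − r⁻⁶/6`), `≈ −0.014` at `ε = a/100`.  So `Φ₀ = ½ + λ` with an antisymmetric,
   translation/rotation-blind, finite-range LINEAR bond transfer `λ` cancelling every site's first
   variation is required.  Zero virial stress `Σ_δ δ ⊗ V'(|δ|)δ̂ = 0` is NECESSARY (homogeneous strains are
   invisible to translation-covariant antisymmetric transfers) — exactly what `HcpFamilyMin` supplies
   (`∂_a e = ∂_h e = 0`) — and for a Bravais lattice sufficient (the obstruction class of
   `φ_k(u) = ½ Σ_j V'(r_kj) ê_kj·(u_j − u_k)` in `I/I² ≅ ℝ³ ⊗ ℝ³`, `I` the augmentation ideal of the lattice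
   group ring, IS the stress; the hcp basis adds internal equilibrium, free by symmetry).  Not in the tree.
3. SECOND ORDER.  9333 (`Theses/ExcessDecayLiouville.PhononStability`, itself open) is the GLOBAL harmonic
   inequality `½ Σ_{p≠q} (u_p−u_q)ᵀK(p−q)(u_p−u_q) ≥ κ Σ_{|p−q|≤1.1} |u_p−u_q|²` for finitely supported `u`.
   S2b needs the SITEWISE form: per-site quadratic forms `q_k ≥ κ'·|strain at k|²` differing from the naive
   split by finite-range antisymmetric transfers (a decomposition of the hcp dynamical matrix into locally
   supported positive forms).  Global positivity does not imply it; 9333 neither states nor implies it.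
4. BEYOND: cubic remainders uniform up to `η₀ = a/100` (the route's own `|V‴/V″| ≈ 20` puts the honest
   perturbative radius near `a/400`); the `r⁻⁶` far field of bonds longer than `R` (first order in the far
   strain, `~R⁻³`, against zero local budget); consistency of bond-wise reference frames.
5. The pin `a ≥ 0.945` (only for "all bonds attractive", §4 — not needed in §3) would follow from
   `HcpFamilyMin` via `ExcessDecayLiouvilleCoarseGrains.hcpSum_main` once `e(hcp(a,h))` is identified with
   the certified series `hcpSumS` (shape `h/a ∈ [0.808, 0.825] ⊂ [0.78, 0.85]`).

Sources: FrieseckeTheil2002, EMing2006, HudsonOrtner2011, Miekisz1998, BlancLewin2015, HalesDSP2012 §1.3.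
-/

noncomputable section

namespace Summit.AtomisticToContinuum.Crystallization.Theorems.StrictSplittingRuleBirth

open scoped BigOperators Classical
open Literature.MathematicalPhysics.StatisticalMechanics
open Literature.Geometry.DiscreteGeometry

/-- Euclidean `3`-space. -/
local notation "E3" => EuclideanSpace ℝ (Fin 3)

/-! ## §1  Sign of the Lennard-Jones potential (sharp threshold `r⁶ = 1/2`) -/

/-- `V_LJ(r) < 0 ↔ r⁶ > 1/2` for `r > 0` (`V = (1 − 2r⁶)/(12 r¹²)`). [folklore] -/
theorem perturbative_lennardJones_neg_iff {r : ℝ} (hr : 0 < r) :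
    lennardJones r < 0 ↔ 1 / 2 < r ^ 6 := by
  have h6 : 0 < r ^ 6 := by positivity
  have key : lennardJones r = (1 - 2 * r ^ 6) / (12 * (r ^ 6) ^ 2) := by
    unfold lennardJones; field_simp; ring
  rw [key, div_neg_iff]
  constructor
  · rintro (⟨h1, h2⟩ | ⟨h1, h2⟩)
    · nlinarith
    · linarith
  · intro h
    exact Or.inr ⟨by linarith, by positivity⟩

/-- `V_LJ(r) < 0` for `r ≥ 9/10` (`0.9⁶ = 0.531441 > 1/2`). [folklore] -/
theorem perturbative_lennardJones_neg_of_le {r : ℝ} (hr : 9 / 10 ≤ r) : lennardJones r < 0 :=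
  (perturbative_lennardJones_neg_iff (lt_of_lt_of_le (by norm_num) hr)).2
    (lt_of_lt_of_le (by norm_num) (pow_le_pow_left₀ (by norm_num) hr 6))

/-! ## §2  Goodness read off a pattern; the composite rule -/

/-- Membership in `patternShell`. -/
theorem perturbative_mem_patternShell {a : ℝ} {T : Finset E3} {w z : E3} :
    z ∈ patternShell a T w ↔ ∃ u ∈ T, u ≠ w ∧ dist u w ≤ 5 * a / 4 ∧ u - w = z := by
  simp only [patternShell, Finset.mem_image, Finset.mem_filter, and_assoc]

/-- Recentring the pattern by `v` turns the shell around `v` into the shell around `0`. -/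
theorem perturbative_patternShell_shift_zero (a : ℝ) (T : Finset E3) (v : E3) :
    patternShell a (T.image fun u => u - v) 0 = patternShell a T v := by
  ext z
  simp only [perturbative_mem_patternShell, Finset.mem_image]
  constructor
  · rintro ⟨u', ⟨u, hu, rfl⟩, hne, hle, rfl⟩
    refine ⟨u, hu, fun h => hne (by rw [h, sub_self]), ?_, by rw [sub_zero]⟩
    rwa [dist_zero_right, ← dist_eq_norm] at hle
  · rintro ⟨u, hu, hne, hle, rfl⟩
    refine ⟨u - v, ⟨u, hu, rfl⟩, sub_ne_zero.2 hne, ?_, sub_zero _⟩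
    rwa [dist_zero_right, ← dist_eq_norm]

/-- Recentring the pattern by `v` turns the shell around `0` into the shell around `−v`. -/
theorem perturbative_patternShell_shift_neg (a : ℝ) (T : Finset E3) (v : E3) :
    patternShell a (T.image fun u => u - v) (-v) = patternShell a T 0 := by
  ext z
  simp only [perturbative_mem_patternShell, Finset.mem_image]
  have hd : ∀ u : E3, dist (u - v) (-v) = dist u 0 := fun u => by
    rw [dist_eq_norm, dist_eq_norm, sub_neg_eq_add, sub_add_cancel, sub_zero]
  have hs : ∀ u : E3, u - v - -v = u - 0 := fun u => by rw [sub_neg_eq_add, sub_add_cancel, sub_zero]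
  constructor
  · rintro ⟨u', ⟨u, hu, rfl⟩, hne, hle, rfl⟩
    exact ⟨u, hu, fun h => hne (by rw [h, zero_sub]), by rwa [hd] at hle, (hs u).symm⟩
  · rintro ⟨u, hu, hne, hle, rfl⟩
    exact ⟨u - v, ⟨u, hu, rfl⟩, fun h => hne (by simpa using congrArg (fun w : E3 => w + v) h),
      by rwa [hd], hs u⟩

/-- **The composite rule is a rule** (box + complementarity) whenever the inner rule is: the swap
`v ↦ −v`, `T ↦ T − v` exchanges the roles of the two endpoints and preserves `|v|`. -/
theorem perturbative_isRule (a t η₀ : ℝ) {Φ₀ : E3 → Finset E3 → ℝ} (h₀ : IsRule Φ₀) :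
    IsRule (compositeRule a t η₀ Φ₀) := by
  refine ⟨fun v T => ?_, fun v T hv => ?_⟩
  · obtain ⟨hlo, hhi⟩ := h₀.1 v T
    unfold compositeRule
    split_ifs <;> first | exact ⟨hlo, hhi⟩ | exact ⟨le_rfl, zero_le_one⟩ | exact ⟨zero_le_one, le_rfl⟩
  · have hc := h₀.2 v T hv
    have e0 : GoodAt a t η₀ (T.image fun u => u - v) 0 ↔ GoodAt a t η₀ T v := by
      unfold GoodAt; rw [perturbative_patternShell_shift_zero]
    have e1 : GoodAt a t η₀ (T.image fun u => u - v) (-v) ↔ GoodAt a t η₀ T 0 := by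
      unfold GoodAt; rw [perturbative_patternShell_shift_neg]
    by_cases g0 : GoodAt a t η₀ T 0 <;> by_cases gv : GoodAt a t η₀ T v <;>
      by_cases hs : lennardJones ‖v‖ ≤ 0 <;>
      simp only [compositeRule, e0, e1, g0, gv, hs, norm_neg, if_true, if_false] <;>
      linarith

/-! ## §3  Reading the two first shells off the realised joint pattern -/

/-- `siteE` written with `bondPattern` (definitional). -/
theorem perturbative_siteE_eq (R : ℝ) (Φ : E3 → Finset E3 → ℝ) {N : ℕ} (x : Fin N → E3) (k : Fin N) :
    siteE R Φ x k = ∑ j ∈ Finset.univ.erase k,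
      Φ (x j - x k) (bondPattern R x k j) * lennardJones (dist (x k) (x j)) :=
  rfl

/-- A `δ`-separated configuration (`δ > 0`) is injective. -/
theorem perturbative_injective_of_sep {δ : ℝ} (hδ : 0 < δ) {N : ℕ} {x : Fin N → E3} (hx : Sep δ x) :
    Function.Injective x := fun i j hij => by
  by_contra hne
  have h := hx i j hne
  rw [hij, dist_self] at h
  exact absurd h (not_le.mpr hδ)

/-- For `R ≥ 5a/4` the joint pattern of `(k,j)` shows the first shell of `k` exactly. -/
theorem perturbative_patternShell_realised_zero {N : ℕ} {x : Fin N → E3} (hx : Function.Injective x)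
    {a R : ℝ} (haR : 5 * a / 4 ≤ R) (k j : Fin N) :
    patternShell a (bondPattern R x k j) 0 = shell a x k := by
  ext z
  simp only [perturbative_mem_patternShell, bondPattern, shell, Finset.mem_image,
    Finset.mem_filter, Finset.mem_univ, true_and]
  constructor
  · rintro ⟨u, ⟨l, -, rfl⟩, hne, hle, rfl⟩
    refine ⟨l, ⟨fun h => hne (by rw [h, sub_self]), ?_⟩, by rw [sub_zero]⟩
    rwa [dist_zero_right, ← dist_eq_norm] at hle
  · rintro ⟨l, ⟨hl, hle⟩, rfl⟩
    refine ⟨x l - x k, ⟨l, Or.inl (hle.trans haR), rfl⟩, sub_ne_zero.2 (hx.ne hl), ?_, sub_zero _⟩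
    rwa [dist_zero_right, ← dist_eq_norm]

/-- For `R ≥ 5a/4` the joint pattern of `(k,j)` shows the first shell of `j` exactly (around the
point `x_j − x_k`). -/
theorem perturbative_patternShell_realised_far {N : ℕ} {x : Fin N → E3} (hx : Function.Injective x)
    {a R : ℝ} (haR : 5 * a / 4 ≤ R) (k j : Fin N) :
    patternShell a (bondPattern R x k j) (x j - x k) = shell a x j := by
  ext z
  simp only [perturbative_mem_patternShell, bondPattern, shell, Finset.mem_image,
    Finset.mem_filter, Finset.mem_univ, true_and]
  have hd : ∀ l, dist (x l - x k) (x j - x k) = dist (x l) (x j) := fun l => by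
    rw [dist_eq_norm, dist_eq_norm, sub_sub_sub_cancel_right]
  constructor
  · rintro ⟨u, ⟨l, -, rfl⟩, hne, hle, rfl⟩
    refine ⟨l, ⟨fun h => hne (by rw [h]), by rwa [hd] at hle⟩, (sub_sub_sub_cancel_right _ _ _).symm⟩
  · rintro ⟨l, ⟨hl, hle⟩, rfl⟩
    refine ⟨x l - x k, ⟨l, Or.inr (hle.trans haR), rfl⟩, fun h => hl (hx (sub_left_injective h)),
      by rwa [hd], sub_sub_sub_cancel_right _ _ _⟩

/-- **Bad neighbours only help a good site.**  At a good site `k` (radius `R ≥ 5a/4`, injective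
configuration) the composite rule's weighted site energy is at least the good-neighbour part under
`Φ₀`: bonds to bad sites contribute `0` (attractive) or `V > 0` (repulsive, weight `1`). -/
theorem perturbative_siteE_ge {N : ℕ} {x : Fin N → E3} (hx : Function.Injective x) {a R : ℝ}
    (haR : 5 * a / 4 ≤ R) (t η₀ : ℝ) (Φ₀ : E3 → Finset E3 → ℝ) {k : Fin N}
    (hk : ShellCloseTo η₀ (shell a x k) (target a t)) :
    goodSum a t η₀ R Φ₀ x k ≤ siteE R (compositeRule a t η₀ Φ₀) x k := by
  rw [perturbative_siteE_eq, goodSum,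
    ← Finset.sum_filter_add_sum_filter_not (Finset.univ.erase k)
      (fun j => ShellCloseTo η₀ (shell a x j) (target a t))]
  have hsplit : ∀ j : Fin N, compositeRule a t η₀ Φ₀ (x j - x k) (bondPattern R x k j) =
      if ShellCloseTo η₀ (shell a x j) (target a t) then Φ₀ (x j - x k) (bondPattern R x k j)
      else if lennardJones ‖x j - x k‖ ≤ 0 then 0 else 1 := by
    intro j
    have g0 : GoodAt a t η₀ (bondPattern R x k j) 0 := by
      unfold GoodAt; rw [perturbative_patternShell_realised_zero hx haR]; exact hk
    have gv : GoodAt a t η₀ (bondPattern R x k j) (x j - x k) ↔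
        ShellCloseTo η₀ (shell a x j) (target a t) := by
      unfold GoodAt; rw [perturbative_patternShell_realised_far hx haR]
    unfold compositeRule
    rw [if_pos g0]
    simp only [gv]
  refine le_add_of_le_of_nonneg (le_of_eq (Finset.sum_congr rfl fun j hj => ?_))
    (Finset.sum_nonneg fun j hj => ?_)
  · rw [Finset.mem_filter] at hj
    rw [hsplit j, if_pos hj.2]
  · rw [Finset.mem_filter] at hj
    rw [hsplit j, if_neg hj.2, ← dist_eq_norm, dist_comm]
    split_ifs with hs
    · rw [zero_mul]
    · rw [one_mul]
      exact (not_le.mp hs).le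

/-! ## §4  Geometry of a good site -/

/-- Points of the stretched shell `S(a,t)` (`|t| ≤ 1/100`) have norm in `(0.99a, 1.01a)`. -/
theorem perturbative_norm_target {a t : ℝ} (ha : 0 < a) (ht : |t| ≤ 1 / 100) {q : E3}
    (hq : q ∈ target a t) : 99 / 100 * a < ‖q‖ ∧ ‖q‖ < 101 / 100 * a := by
  obtain ⟨u, hu, rfl⟩ := Finset.mem_image.1 hq
  have h := ShellRigidityHcpBirth.stub_normFacts a t ha ht u hu
  exact ⟨h.1, h.2.1⟩

/-- The stretched shell `S(a,t)` has exactly twelve points (the stretch moves each point of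
`a·hcpKissingPattern` by `≤ a/100 <` half the minimal distance `a`). -/
theorem perturbative_card_target {a t : ℝ} (ha : 0 < a) (ht : |t| ≤ 1 / 100) :
    (target a t).card = 12 := by
  unfold target
  set f : E3 → E3 := fun u => a • (u + (t * (u 0 + u 1 + u 2) / 3) • intVec ![1, 1, 1]) with hf
  rw [Finset.card_image_of_injOn, card_hcpKissingPattern]
  intro u hu u' hu' h
  by_contra hne
  have h1 : ‖f u - a • u‖ ≤ a / 100 := (ShellRigidityHcpBirth.stub_normFacts a t ha ht u hu).2.2
  have h2 : ‖f u' - a • u'‖ ≤ a / 100 := (ShellRigidityHcpBirth.stub_normFacts a t ha ht u' hu').2.2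
  have hd : 1 ≤ dist u u' :=
    one_le_dist_of_mem_hcpKissingPattern (Finset.mem_coe.1 hu) (Finset.mem_coe.1 hu') hne
  have hbig : a ≤ ‖a • u - a • u'‖ := by
    rw [← smul_sub, norm_smul, Real.norm_of_nonneg ha.le, ← dist_eq_norm]; nlinarith
  have hsmall : ‖a • u - a • u'‖ ≤ a / 100 + a / 100 := by
    have hf' : f u = f u' := h
    calc ‖a • u - a • u'‖ = ‖(f u' - a • u') - (f u - a • u)‖ := by rw [hf']; congr 1; abel
      _ ≤ ‖f u' - a • u'‖ + ‖f u - a • u‖ := norm_sub_le _ _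
      _ ≤ a / 100 + a / 100 := add_le_add h2 h1
  linarith

/-- A good site has exactly twelve neighbours within `5a/4`. -/
theorem perturbative_card_shell {η a t : ℝ} (ha : 0 < a) (ht : |t| ≤ 1 / 100) {N : ℕ}
    {x : Fin N → E3} {k : Fin N} (hk : ShellCloseTo η (shell a x k) (target a t)) :
    (shell a x k).card = 12 := by
  rw [hk.card_eq, perturbative_card_target ha ht]

/-- The shell points of a good site have norm in `(0.99a − η₀, 1.01a + η₀)`. -/
theorem perturbative_norm_of_mem_shell {η₀ a t : ℝ} (ha : 0 < a) (ht : |t| ≤ 1 / 100) {N : ℕ}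
    {x : Fin N → E3} {k : Fin N} (hk : ShellCloseTo η₀ (shell a x k) (target a t)) {z : E3}
    (hz : z ∈ shell a x k) : 99 / 100 * a - η₀ < ‖z‖ ∧ ‖z‖ < 101 / 100 * a + η₀ := by
  obtain ⟨A, e, he⟩ := hk
  have hmem : ((e ⟨z, hz⟩ : E3)) ∈ (target a t).image A := (e ⟨z, hz⟩).2
  obtain ⟨q, hq, hqe⟩ := Finset.mem_image.1 hmem
  have hdist : dist z (e ⟨z, hz⟩ : E3) ≤ η₀ := he ⟨z, hz⟩
  rw [← hqe, dist_eq_norm] at hdist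
  obtain ⟨hlo, hhi⟩ := perturbative_norm_target ha ht hq
  have habs : |‖z‖ - ‖A q‖| ≤ η₀ := (abs_norm_sub_norm_le z (A q)).trans hdist
  rw [A.norm_map, abs_le] at habs
  exact ⟨by linarith [habs.1], by linarith [habs.2]⟩

/-- **Every other site is at distance `> 0.98a` from a good site** (`η₀ ≤ a/100`): sites within
`5a/4` are shell points (norm `> 0.99a − η₀`), the others are beyond `5a/4`. -/
theorem perturbative_dist_of_good {η₀ a t : ℝ} (ha : 0 < a) (ht : |t| ≤ 1 / 100) (hη : η₀ ≤ a / 100)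
    {N : ℕ} {x : Fin N → E3} {k : Fin N} (hk : ShellCloseTo η₀ (shell a x k) (target a t))
    {j : Fin N} (hj : j ≠ k) : 49 / 50 * a < dist (x j) (x k) := by
  by_cases hd : dist (x j) (x k) ≤ 5 * a / 4
  · have hz : x j - x k ∈ shell a x k := by
      unfold shell
      exact Finset.mem_image.2 ⟨j, Finset.mem_filter.2 ⟨Finset.mem_univ _, hj, hd⟩, rfl⟩
    have h := (perturbative_norm_of_mem_shell ha ht hk hz).1
    rw [← dist_eq_norm] at h; linarith
  · push Not at hd; linarith

/-- **All bonds of a good site are strictly attractive** once `a ≥ 45/49` (then `0.98a ≥ 0.9`). -/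
theorem perturbative_attractive_of_good {η₀ a t : ℝ} (ha : 45 / 49 ≤ a) (ht : |t| ≤ 1 / 100)
    (hη : η₀ ≤ a / 100) {N : ℕ} {x : Fin N → E3} {k : Fin N}
    (hk : ShellCloseTo η₀ (shell a x k) (target a t)) {j : Fin N} (hj : j ≠ k) :
    lennardJones (dist (x k) (x j)) < 0 := by
  have h := perturbative_dist_of_good (lt_of_lt_of_le (by norm_num) ha) ht hη hk hj
  rw [dist_comm] at h
  exact perturbative_lennardJones_neg_of_le (by linarith)

/-! ## §5  The reduction of S2b to sitewise coercivity of the good-neighbour sum -/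

/-- **S2b from the core at any threshold `e ≥ e_∞`**: the composite rule built on the core's `Φ₀`
(radius `max R₀ (5a/4)`) has slack `≥ 0` and is strict at good sites. -/
theorem perturbative_certificate_of_core {δ a t η₀ e : ℝ} (hδ : 0 < δ) (he : eInf ≤ e)
    (hcore : PerturbativeCore δ a t η₀ e) :
    ∃ R₀ : ℝ, ∀ R : ℝ, R₀ ≤ R → ∃ Φ : E3 → Finset E3 → ℝ, IsRule Φ ∧
      (∀ (N : ℕ) (x : Fin N → E3), Sep δ x → ∀ k : Fin N,
          ShellCloseTo η₀ (shell a x k) (target a t) → eInf ≤ siteE R Φ x k) ∧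
      ∀ η : ℝ, 0 < η → ∃ c : ℝ, 0 < c ∧ ∀ (N : ℕ) (x : Fin N → E3), Sep δ x → ∀ k : Fin N,
        ShellCloseTo η₀ (shell a x k) (target a t) → siteE R Φ x k < eInf + c →
          ShellCloseTo η (shell a x k) (target a t) := by
  obtain ⟨R₀, hR₀⟩ := hcore
  refine ⟨max R₀ (5 * a / 4), fun R hR => ?_⟩
  obtain ⟨Φ₀, hrule, hii, hiii⟩ := hR₀ R ((le_max_left _ _).trans hR)
  have haR : 5 * a / 4 ≤ R := (le_max_right _ _).trans hR
  refine ⟨compositeRule a t η₀ Φ₀, perturbative_isRule a t η₀ hrule, fun N x hx k hk => ?_,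
    fun η hη => ?_⟩
  · exact (he.trans (hii N x hx k hk)).trans
      (perturbative_siteE_ge (perturbative_injective_of_sep hδ hx) haR t η₀ Φ₀ hk)
  · obtain ⟨c, hc, hstr⟩ := hiii η hη
    exact ⟨c, hc, fun N x hx k hk hlt => hstr N x hx k hk ((((perturbative_siteE_ge
      (perturbative_injective_of_sep hδ hx) haR t η₀ Φ₀ hk).trans_lt hlt)).trans_le
        (add_le_add_left he c))⟩

/-- **The registered signature of S2b, VERBATIM, from the core at `e = e(hcp(a,h))`** (then
`e_∞ ≤ e(hcp(a,h))` is the landed `PeriodicUpperBound`).  This is the exact remaining obligation. -/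
theorem stub_perturbativeReduction :
    (∀ δ : ℝ, 0 < δ → ∀ a h t η₀ : ℝ, 0 < a → |t| ≤ 1 / 100 →
      h = (1 + t) * a * Real.sqrt (2 / 3) → HcpFamilyMin a h → ∀ (ha : a ≠ 0) (hh : h ≠ 0),
        0 < η₀ → η₀ ≤ a / 100 →
          PerturbativeCore δ a t η₀ ((hcpPeriodicConfiguration ha hh).energyPerParticle lennardJones)) →
    ∀ δ : ℝ, 0 < δ → ∀ a h t η₀ : ℝ, 0 < a → |t| ≤ 1 / 100 → h = (1 + t) * a * Real.sqrt (2 / 3) →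
      HcpFamilyMin a h → 0 < η₀ → η₀ ≤ a / 100 → ∃ R₀ : ℝ, ∀ R : ℝ, R₀ ≤ R →
        ∃ Φ : E3 → Finset E3 → ℝ, IsRule Φ ∧
          (∀ (N : ℕ) (x : Fin N → E3), Sep δ x → ∀ k : Fin N,
              ShellCloseTo η₀ (shell a x k) (target a t) → eInf ≤ siteE R Φ x k) ∧
          ∀ η : ℝ, 0 < η → ∃ c : ℝ, 0 < c ∧ ∀ (N : ℕ) (x : Fin N → E3), Sep δ x → ∀ k : Fin N,
            ShellCloseTo η₀ (shell a x k) (target a t) → siteE R Φ x k < eInf + c →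
              ShellCloseTo η (shell a x k) (target a t) := by
  intro hcore δ hδ a h t η₀ ha ht hht hmin hη₀ hη₀a
  obtain ⟨ha', hh', hmin'⟩ := hmin
  have hP := periodicUpperBound_proof
  unfold Summit.AtomisticToContinuum.Crystallization.Theses.FreeSplittingCertificates.PeriodicUpperBound
    at hP
  exact perturbative_certificate_of_core hδ (hP _)
    (hcore δ hδ a h t η₀ ha ht hht ⟨ha', hh', hmin'⟩ ha' hh' hη₀ hη₀a)

end Summit.AtomisticToContinuum.Crystallization.Theorems.StrictSplittingRuleBirth

end
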